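import Mathlib
import HarnessLib
import Summits.Ventures.LatticeQCDFlow.Exactness.PolarChartSU3

/-!
# The inverse of the polar `SU(3)` cell chart (`polar3_from_x`): explicit inverse factors, left/right inverse identities, and the alcove read in box coordinates

HONEST FRAMING: exact (Metropolis-corrected) sampling algorithms for lattice gauge theory;
figures of merit are autocorrelation/cost numbers at stated couplings and volumes; no
continuum-physics claim.

Venture `LatticeQCDFlow` (cell pub-lqcd), topic `Exactness`; FANOUT row 10 (`eng-equiv`, engine
`latflow.equiv` v0.3 `spectral.polar3_from_x` = `(φ/(π/3), r/R(φ))` with `φ = atan2`, `r = √(a²+b²)`;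
Abbott et al. 2305.02402 §4.1.1, named only).  NEW WORK of the cell over `PolarChartSU3` (the forward
factors `T` box → wedge and `Q` wedge → alcove) and Mathlib's `arctan` calculus.  With
`P = −θ₀/2 = ρ cos φ` and `Qv = (−θ₀/2 − θ₁)/√3 = ρ sin φ`:
`Q⁻¹(θ) = (arctan(Qv/P), P·√(1 + (Qv/P)²))`, `T⁻¹(φ, ρ) = (φ/(π/3), ρ·√3 cos(φ − π/6)/π)` — the
typed content of the engine's inverse chart, and exactly what the polar twin of
`SU3SpectralKernelBookedBoxFlow` needs (left inverses only).  Nothing is cited as a fact; no number;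
no definition (the four maps are function variables pinned by their defining equations).

* `boxToWedge_leftInverse_su3` (`T⁻¹(T a) = a` wherever `cos ψ ≠ 0`), `boxToWedge_rightInverse_su3`;
* `wedgeToAlcove_leftInverse_su3` (`Q⁻¹(Q z) = z` on `{0 < φ < π/3, 0 < ρ}`: `arctan ∘ tan`, `√(1+tan²) = 1/cos`),
  `wedgeToAlcove_rightInverse_su3` (`Q(Q⁻¹ θ) = θ` whenever `θ₀ < 0`);
* `wedgeInv_mem_wedge_su3` (the alcove in wedge coordinates), `polarInv_mem_box_su3` (… in box coordinates),
  **`polarChart_polarInv_su3`** (`(Q∘T)(T⁻¹(Q⁻¹ θ)) = θ` on the alcove).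
-/

noncomputable section

namespace Summit.Ventures.LatticeQCDFlow.Exactness

open Set Real

section Inverse

variable {T Q Ti Qi : (Fin 2 → ℝ) → (Fin 2 → ℝ)}
  (hT : ∀ a, T a = ![π / 3 * a 0, a 1 * (π / (Real.sqrt 3 * Real.cos (π / 3 * a 0 - π / 6)))])
  (hQ : ∀ z, Q z = ![-2 * z 1 * Real.cos (z 0), z 1 * Real.cos (z 0) - Real.sqrt 3 * z 1 * Real.sin (z 0)])
  (hTi : ∀ z, Ti z = ![z 0 / (π / 3), z 1 / (π / (Real.sqrt 3 * Real.cos (z 0 - π / 6)))])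
  (hQi : ∀ θ, Qi θ = ![Real.arctan (((-θ 0 / 2 - θ 1) / Real.sqrt 3) / (-θ 0 / 2)),
    (-θ 0 / 2) * Real.sqrt (1 + (((-θ 0 / 2 - θ 1) / Real.sqrt 3) / (-θ 0 / 2)) ^ 2)])

include hT hTi in
/-- `T⁻¹ (T a) = a` wherever `cos(π/3·a₀ − π/6) ≠ 0` (in particular on the box). -/
theorem boxToWedge_leftInverse_su3 (a : Fin 2 → ℝ) (hc : Real.cos (π / 3 * a 0 - π / 6) ≠ 0) :
    Ti (T a) = a := by
  have hπ := Real.pi_pos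
  have h3 : Real.sqrt 3 ≠ 0 := Real.sqrt_ne_zero'.mpr (by norm_num)
  rw [hT, hTi]
  simp only [Matrix.cons_val_zero, Matrix.cons_val_one]
  funext i
  fin_cases i
  · simp only [Fin.zero_eta, Matrix.cons_val_zero]
    field_simp
  · simp only [Fin.mk_one, Matrix.cons_val_one, Matrix.cons_val_zero]
    have hg : π / (Real.sqrt 3 * Real.cos (π / 3 * a 0 - π / 6)) ≠ 0 := by
      exact div_ne_zero hπ.ne' (mul_ne_zero h3 hc)
    exact mul_div_cancel_right₀ _ hg

include hT hTi in
/-- `T (T⁻¹ z) = z` wherever `cos(z₀ − π/6) ≠ 0`. -/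
theorem boxToWedge_rightInverse_su3 (z : Fin 2 → ℝ) (hc : Real.cos (z 0 - π / 6) ≠ 0) :
    T (Ti z) = z := by
  have hπ := Real.pi_pos
  have h3 : Real.sqrt 3 ≠ 0 := Real.sqrt_ne_zero'.mpr (by norm_num)
  rw [hTi, hT]
  simp only [Matrix.cons_val_zero, Matrix.cons_val_one]
  have e0 : π / 3 * (z 0 / (π / 3)) = z 0 := by field_simp
  funext i
  fin_cases i
  · simp only [Fin.zero_eta, Matrix.cons_val_zero]
    exact e0
  · simp only [Fin.mk_one, Matrix.cons_val_one, Matrix.cons_val_zero]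
    rw [e0]
    have hg : π / (Real.sqrt 3 * Real.cos (z 0 - π / 6)) ≠ 0 := div_ne_zero hπ.ne' (mul_ne_zero h3 hc)
    exact div_mul_cancel₀ _ hg

include hQ hQi in
/-- `Q⁻¹ (Q z) = z` on `{0 < φ < π/3, 0 < ρ}`. -/
theorem wedgeToAlcove_leftInverse_su3 (z : Fin 2 → ℝ) (h0 : 0 < z 0) (h1 : z 0 < π / 3) (h2 : 0 < z 1) :
    Qi (Q z) = z := by
  have hπ := Real.pi_pos
  have h3 : (0 : ℝ) < Real.sqrt 3 := Real.sqrt_pos.mpr (by norm_num)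
  obtain ⟨hc, hs, -⟩ := wedgeAngle_pos h0 h1
  rw [hQ, hQi]
  simp only [Matrix.cons_val_zero, Matrix.cons_val_one]
  -- `P = ρ cos φ`, `Qv = ρ sin φ`, `Qv/P = tan φ`
  have hP : -(-2 * z 1 * Real.cos (z 0)) / 2 = z 1 * Real.cos (z 0) := by ring
  have hQv : (-(-2 * z 1 * Real.cos (z 0)) / 2 - (z 1 * Real.cos (z 0) - Real.sqrt 3 * z 1 * Real.sin (z 0))) /
      Real.sqrt 3 = z 1 * Real.sin (z 0) := by
    field_simp
    ring
  rw [hQv, hP]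
  have ht : z 1 * Real.sin (z 0) / (z 1 * Real.cos (z 0)) = Real.tan (z 0) := by
    rw [Real.tan_eq_sin_div_cos]
    field_simp
  rw [ht]
  have hat : Real.arctan (Real.tan (z 0)) = z 0 := Real.arctan_tan (by linarith) (by linarith)
  have hsq : Real.sqrt (1 + Real.tan (z 0) ^ 2) = (Real.cos (z 0))⁻¹ := by
    have h := Real.inv_sqrt_one_add_tan_sq hc
    rw [← h, inv_inv]
  funext i
  fin_cases i
  · simp only [Fin.zero_eta, Matrix.cons_val_zero]
    exact hat
  · simp only [Fin.mk_one, Matrix.cons_val_one, Matrix.cons_val_zero]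
    rw [hsq]
    field_simp

include hQ hQi in
/-- `Q (Q⁻¹ θ) = θ` whenever `θ₀ < 0` (so that `P = −θ₀/2 > 0`). -/
theorem wedgeToAlcove_rightInverse_su3 (θ : Fin 2 → ℝ) (hθ : θ 0 < 0) : Q (Qi θ) = θ := by
  have h3 : (0 : ℝ) < Real.sqrt 3 := Real.sqrt_pos.mpr (by norm_num)
  have hP : 0 < -θ 0 / 2 := by linarith
  set P : ℝ := -θ 0 / 2 with hPdef
  set Qv : ℝ := (-θ 0 / 2 - θ 1) / Real.sqrt 3 with hQdef
  set t : ℝ := Qv / P with htdef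
  have hsq : 0 < Real.sqrt (1 + t ^ 2) := Real.sqrt_pos.mpr (by positivity)
  have hρcos : P * Real.sqrt (1 + t ^ 2) * Real.cos (Real.arctan t) = P := by
    rw [Real.cos_arctan]; field_simp
  have hρsin : P * Real.sqrt (1 + t ^ 2) * Real.sin (Real.arctan t) = Qv := by
    rw [Real.sin_arctan, htdef]; field_simp
  have hsqrt3Q : Real.sqrt 3 * Qv = -θ 0 / 2 - θ 1 := by rw [hQdef]; field_simp
  rw [hQi, hQ]
  simp only [Matrix.cons_val_zero, Matrix.cons_val_one]
  rw [← htdef]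
  funext i
  fin_cases i
  · simp only [Fin.zero_eta, Matrix.cons_val_zero]
    rw [show -2 * (P * Real.sqrt (1 + t ^ 2)) * Real.cos (Real.arctan t) =
      -2 * (P * Real.sqrt (1 + t ^ 2) * Real.cos (Real.arctan t)) by ring, hρcos, hPdef]
    ring
  · simp only [Fin.mk_one, Matrix.cons_val_one, Matrix.cons_val_zero]
    rw [show Real.sqrt 3 * (P * Real.sqrt (1 + t ^ 2)) * Real.sin (Real.arctan t) =
      Real.sqrt 3 * (P * Real.sqrt (1 + t ^ 2) * Real.sin (Real.arctan t)) by ring, hρsin, hρcos, hsqrt3Q, hPdef]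
    ring

include hQi in
/-- **The alcove in wedge coordinates**: for `θ` in the alcove, `Q⁻¹ θ` lies in the wedge
`{0 < φ < π/3, 0 < ρ < π/(√3 cos(φ − π/6))}`. -/
theorem wedgeInv_mem_wedge_su3 (θ : Fin 2 → ℝ) (h01 : θ 0 < θ 1) (h12 : θ 1 < -(θ 0 + θ 1))
    (h20 : -(θ 0 + θ 1) < θ 0 + 2 * π) :
    0 < (Qi θ) 0 ∧ (Qi θ) 0 < π / 3 ∧ 0 < (Qi θ) 1 ∧
      (Qi θ) 1 < π / (Real.sqrt 3 * Real.cos ((Qi θ) 0 - π / 6)) := by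
  have hπ := Real.pi_pos
  have h3 : (0 : ℝ) < Real.sqrt 3 := Real.sqrt_pos.mpr (by norm_num)
  have h33 : Real.sqrt 3 * Real.sqrt 3 = 3 := Real.mul_self_sqrt (by norm_num)
  have hP : 0 < -θ 0 / 2 := by linarith
  have hQ : 0 < (-θ 0 / 2 - θ 1) / Real.sqrt 3 := div_pos (by linarith) h3
  set P : ℝ := -θ 0 / 2 with hPdef
  set Qv : ℝ := (-θ 0 / 2 - θ 1) / Real.sqrt 3 with hQdef
  set t : ℝ := Qv / P with htdef
  have ht : 0 < t := div_pos hQ hP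
  have hsq : 0 < Real.sqrt (1 + t ^ 2) := Real.sqrt_pos.mpr (by positivity)
  have hρcos : P * Real.sqrt (1 + t ^ 2) * Real.cos (Real.arctan t) = P := by
    rw [Real.cos_arctan]; field_simp
  have hρsin : P * Real.sqrt (1 + t ^ 2) * Real.sin (Real.arctan t) = Qv := by
    rw [Real.sin_arctan, htdef]; field_simp
  have hsqrt3Q : Real.sqrt 3 * Qv = -θ 0 / 2 - θ 1 := by rw [hQdef]; field_simp
  have hφ0 : 0 < Real.arctan t := Real.arctan_pos.mpr ht
  have hφ1 : Real.arctan t < π / 3 := by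
    have htlt : t < Real.sqrt 3 := by
      rw [htdef, div_lt_iff₀ hP]
      have : Qv * Real.sqrt 3 < Real.sqrt 3 * P * Real.sqrt 3 := by nlinarith [hsqrt3Q, h33, hP]
      nlinarith [this, h3]
    have := Real.arctan_lt_arctan_iff.mpr htlt
    rwa [← Real.tan_pi_div_three, Real.arctan_tan (by linarith) (by linarith)] at this
  rw [hQi]
  simp only [Matrix.cons_val_zero, Matrix.cons_val_one]
  rw [← htdef]
  refine ⟨hφ0, hφ1, by positivity, ?_⟩
  have hcψ := (wedgeAngle_pos hφ0 hφ1).2.2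
  rw [lt_div_iff₀ (by positivity)]
  have hid := sqrt3_mul_cos_add_sin (Real.arctan t)
  have e : P * Real.sqrt (1 + t ^ 2) * (Real.sqrt 3 * Real.cos (Real.arctan t - π / 6)) =
      (3 * P + Real.sqrt 3 * Qv) / 2 := by
    have e2 : Real.cos (Real.arctan t - π / 6) =
        (Real.sqrt 3 * Real.cos (Real.arctan t) + Real.sin (Real.arctan t)) / 2 := by linarith [hid]
    rw [e2]
    nlinarith [hρcos, hρsin, h33]
  rw [e, hsqrt3Q, hPdef]
  linarith

include hT hQ hTi hQi in
/-- **The alcove in box coordinates**: `T⁻¹ (Q⁻¹ θ) ∈ B = (0,1)²` and `(Q∘T)(T⁻¹(Q⁻¹ θ)) = θ` for every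
`θ` in the alcove. -/
theorem polarInv_mem_box_su3 (θ : Fin 2 → ℝ) (h01 : θ 0 < θ 1) (h12 : θ 1 < -(θ 0 + θ 1))
    (h20 : -(θ 0 + θ 1) < θ 0 + 2 * π) :
    Ti (Qi θ) ∈ Set.pi univ (fun _ : Fin 2 => Ioo (0 : ℝ) 1) ∧ Q (T (Ti (Qi θ))) = θ := by
  have hπ := Real.pi_pos
  have h3 : (0 : ℝ) < Real.sqrt 3 := Real.sqrt_pos.mpr (by norm_num)
  obtain ⟨h0, h1, h2, h4⟩ := wedgeInv_mem_wedge_su3 hQi θ h01 h12 h20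
  have hcψ := (wedgeAngle_pos h0 h1).2.2
  have hg : 0 < π / (Real.sqrt 3 * Real.cos ((Qi θ) 0 - π / 6)) := by positivity
  refine ⟨fun i _ => ?_, ?_⟩
  · rw [hTi]
    fin_cases i
    · simp only [Fin.zero_eta, Matrix.cons_val_zero]
      exact ⟨div_pos h0 (by positivity), (div_lt_one (by positivity)).mpr h1⟩
    · simp only [Fin.mk_one, Matrix.cons_val_one, Matrix.cons_val_zero]
      exact ⟨div_pos h2 hg, (div_lt_one hg).mpr h4⟩
  · rw [boxToWedge_rightInverse_su3 hT hTi _ hcψ.ne']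
    exact wedgeToAlcove_rightInverse_su3 hQ hQi θ (by linarith)

include hT hQ hTi hQi in
/-- `T⁻¹ ∘ Q⁻¹` is a left inverse of the polar chart on the box: `T⁻¹(Q⁻¹((Q∘T) a)) = a` for `a ∈ B`. -/
theorem polarInv_polarChart_su3 {a : Fin 2 → ℝ} (ha : a ∈ Set.pi univ fun _ : Fin 2 => Ioo (0 : ℝ) 1) :
    Ti (Qi (Q (T a))) = a := by
  have hπ := Real.pi_pos
  have ha0 := ha 0 (mem_univ _)
  have ha1 := ha 1 (mem_univ _)
  have hφ0 : 0 < π / 3 * a 0 := by nlinarith [ha0.1]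
  have hφ1 : π / 3 * a 0 < π / 3 := by nlinarith [ha0.2]
  have hc := (wedgeAngle_pos hφ0 hφ1).2.2
  have hmem : T a ∈ {z : Fin 2 → ℝ | 0 < z 0 ∧ z 0 < π / 3 ∧ 0 < z 1 ∧
      z 1 < π / (Real.sqrt 3 * Real.cos (z 0 - π / 6))} := by
    rw [show T = _ from funext hT, ← image_boxToWedge_su3]
    exact mem_image_of_mem _ ha
  obtain ⟨h0, h1, h2, -⟩ := hmem
  rw [wedgeToAlcove_leftInverse_su3 hQ hQi (T a) h0 h1 h2]
  exact boxToWedge_leftInverse_su3 hT hTi a hc.ne'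

end Inverse

end Summit.Ventures.LatticeQCDFlow.Exactness
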